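import Summits.BirchSwinnertonDyer.Rank1Residual.F1Sign2.LevelZeroSpinLawSharpAtTwo
import Summits.BirchSwinnertonDyer.Rank1Residual.F1Sign2.SelmerUnitsAtTwo
import HarnessLib.Audit.Tags
import HarnessLib

/-!
# DESC-42 «Δ_L > 0: THE REAL PLACE IS A LEVEL-1 DATUM» — aligned units, the egg-rescue cell, LAW 42 and the three alignment exclusions (-desc g32, MEMO-desc §42; typer -ty g21)
# v2 = v1 + DOCSTRING FOLDS ONLY (REF2 23:40:43Z addendum: T″ grade, T′/T″ column move, port cites) — every declaration byte-identical to v1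
# v3 = v2 + ONE DOCSTRING PRECISION (REF2 2026-08-30T00:00Z: «h_L odd ⟹ s ∈ {2,3} (Armitage–Fröhlich)», not «cubic ⟹ s ≥ 2») — declarations byte-identical

PORT (typer -ty g21, cell bsd-f1-sign2) of -desc g32's Sketch42 **v2** (`MEMO-desc-data/g32/lean/Sketch42.lean` = REF1-frozen `REF1-data/b274/Sketch42_v2_asis.lean`
6a56ebed73a19d6d, 233 l.; v1 cd66f15ac9044907 + DESC-42-T″ + `eggRescueCell_not_oneRoot`; MEMO-desc §42 incl. §42.10, memo 432cfd5aa5c8d846; rc 0 · 0 err · 0 warn · 0 sorry ·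
-desc BC7 CLEAN).  The planner asked for ONE file; per the port gate's R274c the eleven glue theorems go to the kernel sibling `LevelZeroSpinLawPosDiscAtTwoKernel.lean` (same
flat namespace `Summit.BirchSwinnertonDyer.Rank1Residual.F1Sign2`, so every glue name -desc uses is unchanged — import the kernel module).  This file (imports the landed §41 module
`LevelZeroSpinLawSharpAtTwo.lean` p749388 and the §18 carriers `SelmerUnitsAtTwo.lean`): CARRIERS `EggAlignedUnitsAtTwo W` (no norm-one unit of the cubic 2-division field has sign
type tegg or mid ⟺ `|P_∞| = 4` ⟺ `sgn(𝓞_L^×) = H₂₃`), `NonIsolatedTripleAllEvenAtTwo F` (three `ℚ₂`-roots, none isolated, every `m(Θᵢ)` even: cell `(k₂, λ₂) = (1, 0)`),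
`EggRescueCellAtTwo W c F v₀`; ROWS `@[conjecture]` **DESC-42-D** `LevelZeroSpinLawPosDiscLoneAdditiveTwoAtTwo` (LAW 42, `↔`), **DESC-42-A** `PureSpinLawOfEggAlignedTripleAtTwo`,
**DESC-42-B** `SpinObstructedOfMisalignedTripleAtTwo` (theorem-candidates modulo LAW36′, exactly like DESC-39/40/41); PLAIN **DESC-42-T** `NotEggAlignedOfAllSwitchedOffSharpAtTwo`
(THM 42.2), **DESC-42-T′** `NotEggAlignedOfLoneIsolatedOddTripleAtTwo` (THM 42.1's exclusion in cell (2,1)), **DESC-42-T″** `NotEggAlignedOfLoneConductorOddOneRootAtTwo` (THM 42.1's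
`d₂ = 1` block ∘ THM 37.3; additive AND multiplicative lone `2`) — spin-free, theorem-grade modulo the §37–§41 dictionary; everything VERBATIM (sketch l.33–149), riders appended.
TAGS per REF1 R274c (= the planner's own): D/A/B `@[conjecture]`, T/T′/T″ PLAIN; `0 < cubicDiscZ c` stays adjacent to every use of `EggAlignedUnitsAtTwo` (FALSE identically at
`Δ < 0`, BC7-a).

THE MATHEMATICS (-desc g32; REF1-audited): LEMMA 42.0 (`h_L` odd: EGG-ALIGNED ⟺ semi-narrow class number `h^∞_L = 2h_L` ⟺ `C^∞_L[2] ≠ 0`; indices (2,1)/(4,2), `h⁺ = 2^{3−s}h`);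
THM 42.1 (lone totally-split additive `2` over totally real `L`: finite 𝔽₂-model enumeration, 2 520 configurations in THM 40.1's model — (2,0) pure for both alignments, (2,1) `r = 1`
and ALIGNED IMPOSSIBLE (= T′), (1,1) never pure, **(1,0) ALIGNED ⟹ `r₂ = 0` PURE, else `r₂ = 2`** (= A/B); `d₂ = 1`: 30 configurations, `dRU = 2` forces `λ = 0` (= T″'s lever));
THM 42.2 (all places OFF ∧ `h_L` odd ∧ `Sel₂ = 0` ⟹ not aligned) = Yoo–Yu Thm 1.6 ∘ LEMMA 41.0 ∘ LEMMA 42.0; LAW 42 = DESC-42-D.  BC5 (MEMO-desc §42; kit j336660, pre-registered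
PREDICTIONS42.md 21409103ddb1fc69 echoed in-job; deep j336735): 11 059 lone-2 V1-d2 survivors — cell × alignment census (2,0) 268/593 · (2,1) **0/4 978** · (1,1) 802/3 596 · (1,0)
265/557; arm X all-OFF ⟹ not aligned **8 379/8 379** (+96/96, 30/30); T″ `d₂ = 1` odd-𝔯-bit **0/282** aligned vs 6/22 in the all-even rows; 79 picks: aligned (1,0) PURE 30/30 (439
pure primes incl. deep, 0 deviations), non-aligned (1,0) deviate 30/30 (29 + deep j336735: 36 pure primes, 13 deviating, first at 20 261), (1,1) 8/8 + (2,1) 3/3 not pure, (2,0) 8/8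
pure; ENGINE 38 consistency 79/79; two same-(N, L, h, Kodaira, profile) pairs with opposite alignment AND opposite purity (N = 351 808, 3 046 464) — the level-1 datum is
load-bearing.

PORT GATE = REF1-AUDIT §274 (2026-08-29T23:36:53Z) (-ref1 g23; `REF1-data/b274/`: Probe274.lean 24f107a0a5fdc4f8 / Probe274v2.lean dc5ec7b03100b47b = sketch AS-IS + K274.1–8, rc 0 · 0 · 0 · 0, glue
axioms std; enum42_ref1.py 6076049e6d98158c / enum42d1_ref1.py 1aea69a631cca423 = INDEPENDENT re-parametrisation of THM 42.1's model; tally42 / census42 re-tallies): **ALL SIX ROWS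
SURVIVE — DESC-42-D (`@[conjecture]`, ↔), 42-A, 42-B (`@[conjecture]`), 42-T / T′ / T″ (plain); nothing KILLED; LEMMA 42.0 re-derived; model axioms (α) `U₂ = loc₂ P_∞` ✓ (needs the
OFF dictionary + `h_L` odd = `DegOnePrimesOddClassC` + `Sel₂ = 0`) and (β) `loc₂` injective on `P_∞` ✓, both reduction-type-free; THM 42.1 REPRODUCED (d₂ = 2: 10/10 rows of
`an/linalg42.out` identical; d₂ = 1: 4/4); job42 scorecard 79/79, 0 mismatches; census = memo; frozen-prediction protocol VERIFIED.**  Riders (none changes a row): **R274a** (data, to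
-desc: D's OFF disjunct and the `d₂ ≤ 1` lone-ON cells have no spin arm in job42 — add a `Δ_L > 0` control arm), **R274b** (protocol cosmetics: emit `INCONCLUSIVE` on 6–9 pure
primes; echo the predictions hash in every job), **R274c** (this port: tags, kernel sibling, sign guard), **R274d** (model scope: THM 42.1's r-table is Kodaira-free and (α)/(β)
reduction-type-free, so T″'s multiplicative lone `2` is legitimately covered; external inputs = the OFF dictionary + THM 37.3's `λ₂ ≠ 0 ⟺ ConductorOddAboveOneRoot` at `d = 1`, both
previously audited), **R274e** (§42.10 (ii)'s per-prime deviation-rate statistic is data, not a row).  PARTITION none; beyond-print theorem (kernel): no.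

REF2 PLACEMENT (-ref2 g58, 2026-08-29T23:30:08Z; pre-placement 22:52:37Z: the archimedean Kummer line is PRINT — BPT 2021 Lemma 1.1(ii)): (a) LEMMA 42.0 ELEMENTARY inside the
print object ([cite: YooYu2022, §2.1, Def. 2.3, Rem. 2.4, Lemma 2.5]; under `h_L` odd, Armitage–Fröhlich ⟹ unit signature rank `s ∈ {2, 3}`, `h⁺_L = 2^{3−s}h_L` — REF2 precision
00:00Z) — corollary-of-print, definition-level; (b) THM 42.2 / DESC-42-T = Yoo–Yu Thm 1.6 ∘ LEMMA 41.0 ∘ LEMMA 42.0 — KNOWN / COROLLARY-OF-PRINT theorem-candidate ([cite: YooYu2022, Thm. 1.6, Lemma 2.5]); (c)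
THM 42.1 / DESC-42-T′ — NO PRINT COUNTERPART (REF2's and -desc's null searches; print stops at NICE 2 and at BK77 §7 semistable, acq-01909): BEYOND-PRINT small theorem-candidate,
corollary-of-framework (theorem-grade exactly when REF1 confirms (α)/(β) — §274: confirmed with dependencies stated), new-combination; (d) LAW 42 = DESC-42-D (+ 42-A/B):
CONJECTURE-GRADE, BEYOND PRINT, new-combination — the object (semi-narrow class group / plane `H₂₃`) is Yoo–Yu's, used in print to BOUND `Sel₂` under niceness; delta = (i) a
NON-nice lone additive `2` with `Sel₂ = 0` given, (ii) the decided quantity is the correction class `r₂`, (iii) the deciding bit = parity of `h^∞_L/h_L`; (e) REF2 column: DESC-42-T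
corollary-of-print; DESC-42-T′ beyond-print theorem-candidate (framework); DESC-42-D/A/B beyond-print conjecture-grade; REF2 ADDENDUM 23:40:43Z: DESC-42-T″ same class as T′ — beyond-print small
theorem-candidate, corollary-of-framework, new-combination inside the §37/§40 dictionary; with §274 in, T′/T″ = «beyond-print theorem-grade at framework level (paper), not
kernel-landed», LAW 41's niceness criterion remains the one audited paper-level beyond-print THEOREM with a closed-form statement; beyond-print theorem kernel-landed: none; paper-level audited: LAW 41 only.  OWED (REF2): BK77 §7 comparison when acq-01909
lands.  BSD is not proved by this; 23715 is not closed by this.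
-/

noncomputable section

open scoped Classical

open WeierstrassCurve Literature.NumberTheory.EllipticCurves Literature.NumberTheory.DiophantineGeometry Polynomial IsDedekindDomain NumberField

namespace Summit.BirchSwinnertonDyer.Rank1Residual.F1Sign2

/-! ### §42 vocabulary -/

/-- **ALIGNED UNITS** (`Δ_W > 0`, `W(ℚ)[2] = 0`): every norm-`+1` unit of the ring of integers of the cubic 2-division field `L_W` has sign vector in
`𝒲_∞ = δ_∞(W(ℝ)) = {(+,+,+), (+,−,−)}` (order `e₁ < e₂ < e₃`), i.e. NO norm-one unit is of twist-egg type `(−,−,+)` or of middle type `(−,+,−)`.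
Equivalently `|P_∞| = 4`: all three non-trivial norm-one unit classes are candidates for the `2`-Selmer group at the real place; equivalently the signature
group of `𝓞_L^×` is `H₂₃ = {(a,b,b)}` (unit signature rank 2, the embeddings at the two larger roots coincide on units), which forces narrow class number `2h_L`.
Depends on `W` only through `L_W` AND the order of the roots: the twist `W^{(−1)}` (roots `−e₃ < −e₂ < −e₁`) is aligned iff `sgn(𝓞_L^×) = H₁₂`.
[cite: BrumerKramer1977, §2 (archimedean condition `Ṽ`)] [cite: YooYu2022, Def. 2.1 and §3.1 (semi-narrow class group)]
(RIDER, typer -ty g21: carrier, PLAIN `def`.  REF1-AUDIT §274: FAITHFUL — `∀ α, IsNormOneUnitAtTwo W α → ¬tegg ∧ ¬mid` = «sgn(norm-one unit classes) ⊂ 𝒲_∞ = {1, egg}» = ALIGNED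
(= the `H₂₃` coincidence, LEMMA 42.0 re-derived: indices (2,1)/(4,2), `h⁺ = 2^{3−s}h`, so for `h` odd `dim C_L^∞[2] = 1 ⟺` aligned; internal re-tally 11 059/11 059, 0
violations); BC7-a: the carrier is inhabited by `1` (kernel `isNormOneUnitAtTwo_one`), so the def is decided by sign types, never by vacuity — and for `Δ_W < 0` (one real
embedding) `1` itself has twist-egg type, so `EggAlignedUnitsAtTwo W` is FALSE identically: every row keeps `0 < cubicDiscZ c` adjacent (R274c; do not reuse the carrier without
the sign guard); root order `e₁ < e₂ < e₃` = `IsBranchRealRoot … false/true` of `SelmerUnitsAtTwo.lean`, sign types egg `(+,−,−)` / tegg `(−,−,+)` / mid `(−,+,−)` ✓.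
REF2 (23:30:08Z, (a)): LEMMA 42.0 (`h_L` odd: ALIGNED ⟺ `sgn(𝓞_L^×) = H₂₃` = Yoo–Yu's `Ṽ′` ⟺ `h^∞_L = 2h_L` ⟺ `C^∞_L[2] ≠ 0`) is ELEMENTARY inside the print object —
[cite: YooYu2022, §2.1, Def. 2.3, Rem. 2.4, Lemma 2.5]
(`Ṽ` = BK77's archimedean condition, `Ṽ′`, `P_L^⋆`, indices `2^b / 2^{a+b} / 2^b`; `M₀ ≅ C^∞_L/2`, `M_∞ ≅ C^0_L/2`); consistency from print (REF2 PRECISION 2026-08-30T00:00Z, checked on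
the held text of Dummit–Voight 2018, arXiv 1702.00092 p. 3–4): Armitage–Fröhlich is «ρ⁺ − ρ ≤ ⌊r₁/2⌋»; UNDER `h_L` ODD (the rows' standing hypothesis `DegOnePrimesOddClassC c`:
the kernel of `C⁺_L ↠ C_L` is `{±1}³/sgn(𝓞_L^×) ≅ (ℤ/2)^{3−s} ⊂ C⁺_L`, so `3 − s ≤ ρ⁺ ≤ 1`) the unit signature rank is `s ∈ {2, 3}` and `h⁺_L = 2^{3−s}h_L ∈ {2h_L, h_L}` —
exactly LEMMA 42.0's dichotomy (= REF1 §274's `h⁺ = 2^{3−s}h`); NOT unconditionally: `s = 1` (a totally positive system of fundamental units) occurs for totally real cubics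
(conjectural density ≈ 1.9 %; signature rank 3 / 2 / 1 ≈ 36.3 % / 61.8 % / 1.9 %), and then `4 ∣ h⁺_L`, `h_L` even — outside §42's scope; the conditioned census (rank 3:
47.0 %, rank 2: 53.0 % among `h`-odd lone survivors; «ALIGNED ⟹ signature rank 2 ∧ `h⁺ = 2h`» 1 353/1 353) is consistent in direction with the unconditioned densities, no
claim beyond that; grade corollary-of-print (definition-level).  REF2 port cites (23:40:43Z): the archimedean line (`𝒲_∞ = {1, egg}`, the semi-narrow signature) ←
[cite: BarreraPacettiTornaria2021, Lemma 1.1(ii), Remark 1.2]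
heuristics DV18 / BV15 as Yoo–Yu cite them; BK77 §7 cite-level (acq-01909).) -/
def EggAlignedUnitsAtTwo (W : WeierstrassCurve ℚ) [Fact (Irreducible (twoDivisionUCubic W))] : Prop :=
  ∀ α : twoDivisionAlgebra W, IsNormOneUnitAtTwo W α → ¬ HasTwistEggSignTypeAtTwo W α ∧ ¬ HasMiddleSignTypeAtTwo W α

/-- THE NEW CELL's local datum at an additive `2` with three `ℚ₂`-roots (`disc F ∈ ℚ₂^{×2}` and a Hensel root): NO root is isolated (every `m(Θᵢ) = v₂F′(Θᵢ) ≥ 5`,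
so `k₂ = dim 𝒲₂ ∩ 𝒰₂ = 1` by the LAW 41 rank formula) and every `m(Θᵢ)` is EVEN (`λ₂ = 0`, LEMMA 40.L): cell `(k₂, λ₂) = (1, 0)`, profiles `(6,8,8)`, `(6,10,10)`, …
(a Hensel datum `(e, m)` converges to a root `Θ` with `v₂F′(Θ) = m`, so the universal clause quantifies over the three roots).
(RIDER, typer -ty g21: carrier, PLAIN `def`.  REF1-AUDIT §274 BC7-b: `HenselDatumAtTwo F e m` pins `m = v₂(F′(e))` exactly with `2^{2m+1} ∣ F(e)`, so every datum sits on a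
genuine ℤ₂-root with `m ∈ {m₁, m₂, m₃}` and each root yields one — the universal clause is exactly «profile all even, min ≥ 6» = cell (1,0); with `5 ≤ m` the place satisfies
`NonIsolatedUnramifiedRootAtTwo` (LAW 41 ON for `I_n^*`, `c = 4`) and no §39 `SwitchedOffAt` disjunct fires; disjoint in the kernel from the isolated-root cell (`m = 4`,
`nonIsolatedTripleAllEven_no_isolated_root`, K274.1) and from odd `m` (K274.2).) -/
def NonIsolatedTripleAllEvenAtTwo (F : ℤ[X]) : Prop :=
  IsTwoAdicSquare (cubicDiscZ F) ∧ (∃ (e : ℤ) (m : ℕ), HenselDatumAtTwo F e m) ∧ ∀ (e : ℤ) (m : ℕ), HenselDatumAtTwo F e m → Even m ∧ 5 ≤ m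

/-- THE EGG-RESCUE CELL at a place `v₀ ∣ 2`: switched ON in the sharp sense, not multiplicative (hence additive of LAW 41's `F = 1` types — a good place is §39-OFF),
three local roots (in the cubic-datum currency `c` of §39/§40 AND in the b-invariant currency `F`: the same cubic field), no root isolated, every `m(Θᵢ)` even.
(THM 42.1: here `r₂ = 0` iff the units are aligned.)
(RIDER, typer -ty g21: carrier, PLAIN `def`.  REF1-AUDIT §274 BC7-b/c: INHABITED (822 T42 rows live in it); pairwise disjoint in the kernel from sharp-OFF, sharp-rescuable
(`eggRescueCell_not_off`, `eggRescueCell_not_rescuableSharpAt`, K274.3), the isolated-root cell (K274.1), odd `m` (K274.2) and one local root (`eggRescueCell_not_oneRoot`, K274.7) —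
so DESC-42-D's first two disjuncts are dead inside the cell and its `↔` is not degenerate on either side (OFF: arm X; rescuable: arm R 861 rows; egg ∧ aligned: 265 rows).) -/
def EggRescueCellAtTwo (W : WeierstrassCurve ℚ) (c F : ℤ[X]) (v₀ : HeightOneSpectrum (𝓞 ℚ)) : Prop :=
  SwitchedOnSharpAt W c F v₀ 2 ∧ ¬ W.HasMultiplicativeReductionAt v₀ ∧ ThreeLocalRootsC c 2 ∧ NonIsolatedTripleAllEvenAtTwo F

/-! ### §42 rows -/

/-- **DESC-42-D `LevelZeroSpinLawPosDiscLoneAdditiveTwoAtTwo` (LAW 42: THE LEVEL-0 LAW AT A LONE ADDITIVE `2` IN THE TOTALLY REAL REGIME; `@[conjecture]`, `↔`,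
theorem-candidate modulo LAW36′; MEMO-desc §42).**  Setting of LAW36 with the b-invariant cubic, `Δ_L > 0`, the place `v₀ ∣ 2` additive and every other place
switched off (sharp) (`v₀` not multiplicative: additive, or good and then §39-OFF).  PURE ⟺ `v₀` is sharp-OFF, or sharp-rescuable (LAW 40's `d₂ = 1` 𝔯-even cell; THM 40.1's isolated-root all-even cell), or in the
EGG-RESCUE cell with ALIGNED units.  Mechanism: THM 42.1 (`U₂ = P_∞`, `|P_∞| = 4` iff aligned; cell table by 𝔽₂-linear algebra over THM 40.1) + LAW36′.
The complex-cubic law DESC-41-D is the `|P_∞| = 2` case verbatim; the only sign-dependent cell at an additive lone `2` is `(k₂, λ₂) = (1, 0)`.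
BC5: g31 j336474 Lpos (1,0): aligned 3/3 PURE (`r₂ = 0`; V15n49 `[0,−1,0,−145,−111]`, V15n7 `[0,−1,0,−177,−751]`, V4n50), not aligned 2/2 NOT pure (`r₂ = 2`;
V15n11, V4n48); (2,0) 7/7, (2,1) 8/8, (1,1) 8/8 as predicted; kit job42 (pre-registered PREDICTIONS42.md) = the mass test.  Why it might fail: LAW36′ dictionary;
`U₂ = P_∞` uses `h_L` odd and all odd places OFF (a hidden 2-adic Kummer failure of an aligned unit in the (1,0) cell would give `r₂ = 2`, NOT pure, against the row);
multiplicative / good lone `2` with `Δ_L > 0` deliberately excluded (no data).  Sources: MEMO-desc §37, §40, §41, §42; [cite: BrumerKramer1977, §2, §7];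
[cite: YooYu2022, Def. 2.1, Thm. 1.6]; PR12 arXiv:1104.2941 §4.
(RIDER, typer -ty g21: `@[conjecture]` per REF1 R274c / the planner — conjecture-grade exactly where LAW36′ is.  REF1-AUDIT §274: **SURVIVES** (`↔`; consistent with THM 42.1 in
every `d₂ ≤ 2` cell; its OFF disjunct at `Δ_L > 0` is DESC-41-A's lone-place instance, sign-free, §268; kernel `law42_lone_off_pure`, `law42_eggRescueCell_iff`); model axioms (α)
`U₂ = loc₂(P_∞)` ✓ GIVEN every odd place OFF (the §39/§41 OFF dictionary), `∞` passes iff `sgn ∈ 𝒲_∞`, and `h_L` odd (`DegOnePrimesOddClassC c`), (β) `loc₂` injective on `P_∞` ✓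
(kernel ⊂ `Sel₂ = 0`); THM 42.1 reproduced independently (2 520 + 30 configurations); R274a (data): this row's OFF disjunct and the `d₂ ≤ 1` lone-ON cells have no spin arm in
job42 (prior direct support: 3 `Δ_L > 0` additive-OFF-2 curves / 30 pure primes) — a control arm is asked of -desc; R274d: Kodaira-free model, reduction-type-free axioms.
REF2 (23:30:08Z, (d)): LAW 42 = DESC-42-D (+ kernel corollaries 42-A/B) CONJECTURE-GRADE, BEYOND PRINT, new-combination — as forecast in REF2 add8 §O.4: the object
(semi-narrow class group / plane `H₂₃`) is Yoo–Yu's, used in print to BOUND `Sel₂` under niceness; the delta is (i) a NON-nice lone additive `2` with `Sel₂ = 0` given,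
(ii) the decided quantity is the correction class `r₂` (LAW36′ side), (iii) the deciding bit = parity of `h^∞_L/h_L`; lever's prior use on this problem: BK77 §7 /
[cite: YooYu2022, Thm. 1.6]
(archimedean signature condition in cubic-field 2-descent).  The two same-(N, L, h, Kodaira, profile) pairs with opposite alignment AND opposite purity (N = 351 808,
3 046 464) are the BC5-style witnesses that the level-1 datum is load-bearing.) -/
@[conjecture] def LevelZeroSpinLawPosDiscLoneAdditiveTwoAtTwo : Prop :=
  ∀ (W : WeierstrassCurve ℚ) [W.IsElliptic] [W.IsGloballyMinimal] [Fact (Irreducible (twoDivisionUCubic W))],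
    ∀ (c xnum : ℤ[X]) (xden : ℕ) (B2 B4 B6 : ℤ), CubicDatumFor W c xnum xden → BInvariantsZ W B2 B4 B6 →
      selmerTwoCard W = 1 → DegOnePrimesOddClassC c → 0 < cubicDiscZ c →
        ∀ (v₀ : HeightOneSpectrum (𝓞 ℚ)), PlaceOver v₀ 2 → ¬ W.HasMultiplicativeReductionAt v₀ →
          (∀ (w : HeightOneSpectrum (𝓞 ℚ)) (ℓ : ℕ), PlaceOver w ℓ → w ≠ v₀ → SwitchedOffSharpAt W c (twoDivisionCubicZ B2 B4 B6) w ℓ) →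
            (CorrectedSpinLawFits W c xnum xden [] ↔
              (SwitchedOffSharpAt W c (twoDivisionCubicZ B2 B4 B6) v₀ 2 ∨ RescuableSharpAt W c (twoDivisionCubicZ B2 B4 B6) v₀ 2 ∨
                (EggRescueCellAtTwo W c (twoDivisionCubicZ B2 B4 B6) v₀ ∧ EggAlignedUnitsAtTwo W)))

/-- **DESC-42-A `PureSpinLawOfEggAlignedTripleAtTwo` (the NEW PURE CELL; `@[conjecture]`, theorem-candidate modulo LAW36′).**  `Δ_L > 0`, lone additive `2` in the
egg-rescue cell (three `ℚ₂`-roots, none isolated, all `m` even), units ALIGNED ⟹ the pure `S₃`-spin law fits (`r₂ = 0`: the two-dimensional `U₂ = P_∞` meets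
`ker λ₂ = Ann`-complement trivially — THM 42.1 row `dRU = 2, k = 1, λ = 0 ⟹ r = 0`, 168/168 configurations).  These curves are NOT rescuable in LAW 40/41's sense
(REF1 R268f's witnesses V15n49, V15n7 live here).  A consequence of DESC-42-D (glue `pureSpinLawOfEggAlignedTriple_of_law42`).
(RIDER, typer -ty g21: `@[conjecture]`.  REF1-AUDIT §274: **SURVIVES** — 30 aligned (1,0) curves / 439 pure primes (incl. deep D2–D4: 47 + 43 + 42) / 0 deviations; D ⟹ A in
the kernel (`pureSpinLawOfEggAlignedTriple_of_law42`, std axioms); THM 42.1 row `(1,0), dRU = 2 ⟹ r = 0` reproduced (168/168 configurations).  REF2 (23:30:08Z, (d)/(e)): beyond-print, conjecture-grade (kernel corollary of DESC-42-D via `pureSpinLawOfEggAlignedTriple_of_law42`).) -/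
@[conjecture] def PureSpinLawOfEggAlignedTripleAtTwo : Prop :=
  ∀ (W : WeierstrassCurve ℚ) [W.IsElliptic] [W.IsGloballyMinimal] [Fact (Irreducible (twoDivisionUCubic W))],
    ∀ (c xnum : ℤ[X]) (xden : ℕ) (B2 B4 B6 : ℤ), CubicDatumFor W c xnum xden → BInvariantsZ W B2 B4 B6 →
      selmerTwoCard W = 1 → DegOnePrimesOddClassC c → 0 < cubicDiscZ c → EggAlignedUnitsAtTwo W →
        ∀ (v₀ : HeightOneSpectrum (𝓞 ℚ)), PlaceOver v₀ 2 →
          (∀ (w : HeightOneSpectrum (𝓞 ℚ)) (ℓ : ℕ), PlaceOver w ℓ → w ≠ v₀ → SwitchedOffSharpAt W c (twoDivisionCubicZ B2 B4 B6) w ℓ) →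
            EggRescueCellAtTwo W c (twoDivisionCubicZ B2 B4 B6) v₀ → CorrectedSpinLawFits W c xnum xden []

/-- **DESC-42-B `SpinObstructedOfMisalignedTripleAtTwo` (the visible side of the new cell; `@[conjecture]`, theorem-candidate modulo LAW36′).**  Same cell, units NOT
aligned (`|P_∞| = 2`) ⟹ the pure law FAILS (`r₂ = 2`, exactly as in the complex-cubic case: -desc §41.9, (6,8,8)/(6,10,10) 9/9 NOT pure).  A consequence of DESC-42-D
(glue `spinObstructedOfMisalignedTriple_of_law42`).
(RIDER, typer -ty g21: `@[conjecture]`.  REF1-AUDIT §274: **SURVIVES** — non-aligned (1,0): 30/30 deviate (29 at ≥ 10 pure primes + the 6-pure-prime curve `[0,1,0,−577,−4673]`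
resolved by the pre-registered deep job j336735: 36 pure primes, 13 deviating, first at 20 261; R274b: the script's token `DISAGREE` there should read `INCONCLUSIVE` — cosmetic); D
⟹ B in the kernel (`spinObstructedOfMisalignedTriple_of_law42`); THM 42.1 row `(1,0), dRU = 1 ⟹ r = 2` reproduced.  REF2 (23:30:08Z, (d)/(e)): beyond-print, conjecture-grade (kernel corollary of DESC-42-D via `spinObstructedOfMisalignedTriple_of_law42`).) -/
@[conjecture] def SpinObstructedOfMisalignedTripleAtTwo : Prop :=
  ∀ (W : WeierstrassCurve ℚ) [W.IsElliptic] [W.IsGloballyMinimal] [Fact (Irreducible (twoDivisionUCubic W))],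
    ∀ (c xnum : ℤ[X]) (xden : ℕ) (B2 B4 B6 : ℤ), CubicDatumFor W c xnum xden → BInvariantsZ W B2 B4 B6 →
      selmerTwoCard W = 1 → DegOnePrimesOddClassC c → 0 < cubicDiscZ c → ¬ EggAlignedUnitsAtTwo W →
        ∀ (v₀ : HeightOneSpectrum (𝓞 ℚ)), PlaceOver v₀ 2 →
          (∀ (w : HeightOneSpectrum (𝓞 ℚ)) (ℓ : ℕ), PlaceOver w ℓ → w ≠ v₀ → SwitchedOffSharpAt W c (twoDivisionCubicZ B2 B4 B6) w ℓ) →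
            EggRescueCellAtTwo W c (twoDivisionCubicZ B2 B4 B6) v₀ → ¬ CorrectedSpinLawFits W c xnum xden []

/-- **DESC-42-T `NotEggAlignedOfAllSwitchedOffSharpAtTwo` (THM 42.2, ALIGNMENT EXCLUSION; plain `def`, theorem-grade modulo the explicit 2-descent dictionary —
spin-free).**  `Sel₂(W) = 0`, `W(ℚ)[2] = 0`, `h_L` odd, `Δ_L > 0`, EVERY place switched off (sharp) ⟹ the units are NOT aligned.  Proof (paper): if aligned,
`P_∞ ≅ 𝔽₂²` injects into `𝒰₂` (a `u ∈ P_∞` with `loc₂ u = 0` would lie in `Sel₂ = 0`), `2` OFF means `𝒲₂ ⊂ 𝒰₂` with `dim 𝒲₂ = d₂ + 1`, `dim 𝒰₂ = d₂ + 2`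
(`d₂ = dim W(ℚ₂)[2]`), so `loc₂(P_∞) ∩ 𝒲₂ ≠ 0` gives a non-zero Selmer class — contradiction.  Contrapositive = a Brumer–Kramer-type visibility statement:
everywhere-OFF + aligned ⟹ `Sel₂ ≠ 0`.  Data: census 5/5, arm X of kit job42.  Sources: [cite: BrumerKramer1977, §7]; [cite: YooYu2022, Thm. 1.6]; MEMO-desc §42.
(RIDER, typer -ty g21: PLAIN per REF1 R274c (spin-free, theorem-grade modulo the §37–§41 dictionary).  REF1-AUDIT §274: **SURVIVES** — THM 42.2 checked as a dimension count
(aligned ∧ all OFF ⟹ `U₂ = loc₂P_∞` (dim 2, q-isotropic) and the Lagrangian `𝒲₂` both inside `𝒰₂`, `2 + (d₂+1) > dim 𝒰₂` for `d₂ = 0, 1, 2` ⟹ a non-trivial `u ∈ P_∞` with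
`loc₂ u ∈ 𝒲₂` ⟹ `u ∈ Sel₂ = 0`, contradiction); census arm X **8 379/8 379** re-tallied (0 aligned), X2 96/96, X3 30/30; K274.6: NOT an instance of DESC-42-D (free-standing
target); contrapositive = visibility (`selmerTwoCard_ne_one_of_aligned_allOff`, kernel).
REF2 (23:30:08Z, (b)): THM 42.2 = Yoo–Yu Thm 1.6 (nice at all finite `v` ⟹ `n ≤ dim Sel₂ ≤ n + [K:ℚ]`) ∘ LEMMA 41.0 (OFF ⟹ nice) ∘ LEMMA 42.0: KNOWN /
COROLLARY-OF-PRINT — this row is a corollary-of-print theorem-candidate, landable once the tree has Yoo–Yu 1.6 as a fact or the two-line framework proof typed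
[cite: YooYu2022, Thm. 1.6, Lemma 2.5]) -/
def NotEggAlignedOfAllSwitchedOffSharpAtTwo : Prop :=
  ∀ (W : WeierstrassCurve ℚ) [W.IsElliptic] [W.IsGloballyMinimal] [Fact (Irreducible (twoDivisionUCubic W))],
    ∀ (c xnum : ℤ[X]) (xden : ℕ) (B2 B4 B6 : ℤ), CubicDatumFor W c xnum xden → BInvariantsZ W B2 B4 B6 →
      selmerTwoCard W = 1 → DegOnePrimesOddClassC c → 0 < cubicDiscZ c →
        (∀ (v : HeightOneSpectrum (𝓞 ℚ)) (ℓ : ℕ), PlaceOver v ℓ → SwitchedOffSharpAt W c (twoDivisionCubicZ B2 B4 B6) v ℓ) →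
          ¬ EggAlignedUnitsAtTwo W

/-- **DESC-42-T′ `NotEggAlignedOfLoneIsolatedOddTripleAtTwo` (THM 42.1's exclusion in cell (2,1); plain `def`, theorem-grade modulo the dictionary, spin-free).**
`Sel₂(W) = 0`, `h_L` odd, `Δ_L > 0`, lone additive `2` switched on with three `ℚ₂`-roots, an ISOLATED root (`m = 4`) and some `m` odd ⟹ NOT aligned
(no `q`-Lagrangian `R` with `dim R ∩ 𝒰 = 2` exists in that cell: 0 of 1 344 configurations, `an/linalg42.out`).  Data: (4,7,7) 8/8 + III (4,5,5) 2/2 not aligned; job42.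
(RIDER, typer -ty g21: PLAIN per REF1 R274c (spin-free).  REF1-AUDIT §274: **SURVIVES** — THM 42.1's cell (2,1): `dRU = 2` EMPTY in the independent re-enumeration
(`enum42_ref1.py` 6076049e6d98158c, 2 520 configurations; the `(k=2, λ1, dRU=2)` cell does not occur); census (2,1) ∧ aligned **0/4 978** re-tallied; theorem-grade modulo the
dictionary given (α)/(β) — both confirmed with their dependencies (OFF dictionary, `h_L` odd, `Sel₂ = 0`).
REF2 (23:30:08Z, (c)): NO PRINT COUNTERPART (REF2's null searches: corpus hybrid «unit signature totally real cubic field image of the local Kummer map at 2 additive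
reduction», «narrow class number parity and 2-Selmer group of an elliptic curve with additive reduction at 2» → generic; galaxy «semi-narrow|seminarrow|unit signature rank» 0);
print stops at NICE 2 (Yoo–Yu Thm 1.6; «extremely difficult to exactly compute im(δ_{K_v}) for an even prime») and BK77 §7 (`Δ > 0`, semistable; acq-01909 — additive 2 is
outside BK77's scope).  Grade: BEYOND-PRINT small theorem-candidate, corollary-of-framework (THM 40.1 model axioms (α) `U₂ = loc₂(P_∞)`, (β) `loc₂` injective on `P_∞` —
theorem-grade exactly when REF1 confirms those), new-combination (print object `Ṽ′/C^∞_L` × the cell table at a non-nice 2).  REF2 ADDENDUM (23:40:43Z): with REF1 §274 in, T′ (and T″) move in REF2's column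
from «candidate pending audit» to «beyond-print theorem-grade at framework level (paper), not kernel-landed».) -/
def NotEggAlignedOfLoneIsolatedOddTripleAtTwo : Prop :=
  ∀ (W : WeierstrassCurve ℚ) [W.IsElliptic] [W.IsGloballyMinimal] [Fact (Irreducible (twoDivisionUCubic W))],
    ∀ (c xnum : ℤ[X]) (xden : ℕ) (B2 B4 B6 : ℤ), CubicDatumFor W c xnum xden → BInvariantsZ W B2 B4 B6 →
      selmerTwoCard W = 1 → DegOnePrimesOddClassC c → 0 < cubicDiscZ c →
        ∀ (v₀ : HeightOneSpectrum (𝓞 ℚ)), PlaceOver v₀ 2 → ¬ W.HasMultiplicativeReductionAt v₀ →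
          (∀ (w : HeightOneSpectrum (𝓞 ℚ)) (ℓ : ℕ), PlaceOver w ℓ → w ≠ v₀ → SwitchedOffSharpAt W c (twoDivisionCubicZ B2 B4 B6) w ℓ) →
            SwitchedOnSharpAt W c (twoDivisionCubicZ B2 B4 B6) v₀ 2 → IsTwoAdicSquare (cubicDiscZ (twoDivisionCubicZ B2 B4 B6)) →
              (∃ e : ℤ, HenselDatumAtTwo (twoDivisionCubicZ B2 B4 B6) e 4) → (∃ (e : ℤ) (m : ℕ), HenselDatumAtTwo (twoDivisionCubicZ B2 B4 B6) e m ∧ Odd m) →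
                ¬ EggAlignedUnitsAtTwo W

/-- **DESC-42-T″ `NotEggAlignedOfLoneConductorOddOneRootAtTwo` (THM 42.1's `d₂ = 1` block ∘ THM 37.3's `d = 1` conductor formula; plain `def`,
theorem-grade modulo the dictionary, spin-free, covers additive AND multiplicative lone `2`).**  `Sel₂(W) = 0`, `h_L` odd, `Δ_L > 0`, a lone switched-on place
`v₀ ∣ 2` with exactly ONE `ℚ₂`-root and `ConductorOddAboveOneRoot F 2` (some prime of `L` over `2` divides `𝔯` to an odd power, i.e. `λ₂ ≠ 0`, i.e. the
`d = 1` place is NOT rescuable) ⟹ NOT aligned: with `d₂ = 1` the framework forces `dim(R₂ ∩ 𝒰₂) = 1` unless `λ₂ = 0` (an/linalg42.out `d2=1` block: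
`dRU = 2` occurs only with `λ = 0`), while aligned means `dim(R₂ ∩ 𝒰₂) = 2`.  Data (kit j336660 arm X, lone-`2` `d₂ = 1` rows with an odd `𝔯`-bit):
**0 / 282 aligned** (`I₂` 130, `III` `m = 4` 54, `III` `m = 5` 93, `III*` 3, `I₆` 2) against 6 / 22 aligned in the complementary all-even rows (`I₀*` 4/9, `I₄` 2/13).
Sources: MEMO-desc §37 (THM 37.3), §40 (LAW 40), §42.10.
(RIDER, typer -ty g21: PLAIN per REF1 R274c (spin-free; v2 row, MEMO-desc §42.10).  REF1-AUDIT §274: **SURVIVES** — `d₂ = 1` model re-enumerated independently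
(`enum42d1_ref1.py` 1aea69a631cca423: 30 configurations, 4/4 rows identical; `dRU = 2` forces `λ = 0`, `r = 0` — T″'s lever; alignment changes nothing at `d₂ ≤ 1`); data
re-tallied from `tablex42.txt`: lone-`2` `d₂ = 1` odd-𝔯-bit **0/282** aligned (I₂ 130 · III 147 · III* 3 · I₆ 2) vs all-even 6/22 (I₀* 4/9 · I₄ 2/13); K274.8 (kernel
`not_rescuableAt_of_oneRoot_conductorOdd`): the hypothesis `OneLocalRootC c 2 ∧ ConductorOddAboveOneRoot F 2` is literally ¬(LAW 40's one-root rescue); K274.7: disjoint from the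
egg-rescue cell (`eggRescueCell_not_oneRoot`); R274d: the multiplicative lone `2` is legitimately covered ((α)/(β) reduction-type-free; external input THM 37.3's
`λ₂ ≠ 0 ⟺ ConductorOddAboveOneRoot` at `d = 1`, previously audited).  REF2 ADDENDUM (23:40:43Z): same class as T′ — BEYOND-PRINT small theorem-candidate, corollary-of-framework (THM 42.1 `d₂ = 1` block + THM 37.3 conductor formula; REF1 §274
reproduced the 𝔽₂-model and confirmed (α)/(β) ⟹ theorem-grade at framework level, paper, not kernel-landed), no print counterpart (a lone ON `2` is non-nice by LEMMA 41.0, so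
Yoo–Yu Thm 1.6 is silent; the multiplicative sub-case is `v(D)` EVEN territory, outside Y–Y 1.11(3)), new-combination inside the §37/§40 dictionary.) -/
def NotEggAlignedOfLoneConductorOddOneRootAtTwo : Prop :=
  ∀ (W : WeierstrassCurve ℚ) [W.IsElliptic] [W.IsGloballyMinimal] [Fact (Irreducible (twoDivisionUCubic W))],
    ∀ (c xnum : ℤ[X]) (xden : ℕ) (B2 B4 B6 : ℤ), CubicDatumFor W c xnum xden → BInvariantsZ W B2 B4 B6 →
      selmerTwoCard W = 1 → DegOnePrimesOddClassC c → 0 < cubicDiscZ c →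
        ∀ (v₀ : HeightOneSpectrum (𝓞 ℚ)), PlaceOver v₀ 2 →
          (∀ (w : HeightOneSpectrum (𝓞 ℚ)) (ℓ : ℕ), PlaceOver w ℓ → w ≠ v₀ → SwitchedOffSharpAt W c (twoDivisionCubicZ B2 B4 B6) w ℓ) →
            SwitchedOnSharpAt W c (twoDivisionCubicZ B2 B4 B6) v₀ 2 → OneLocalRootC c 2 →
              ConductorOddAboveOneRoot (twoDivisionCubicZ B2 B4 B6) 2 → ¬ EggAlignedUnitsAtTwo W

end Summit.BirchSwinnertonDyer.Rank1Residual.F1Sign2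

end
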